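import Literature.MathematicalPhysics.QuantumFieldTheory.Balaban1983to89.B8Ineq159FlatCornerDefect
import Literature.MathematicalPhysics.QuantumFieldTheory.Balaban1983to89.B8Eq178Averages
import Literature.MathematicalPhysics.QuantumFieldTheory.Balaban1983to89.B8Ineq172Concrete
import Literature.MathematicalPhysics.QuantumFieldTheory.Balaban1983to89.B8Prop5Reality
import Literature.MathematicalPhysics.QuantumFieldTheory.Balaban1983to89.B8SockHFPCubeMember

/-!
# `Balaban1983to89.B8SockH59CornerDefect` — KERNEL CERTIFICATE: the `𝔸`-valued two-member (1.59) clause of the N05 socket family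
# (`B8LeafModelZd.SockH59` ∕ the `H59₁` display of the Proposition-6-at-`{□_j}` files) AT BACKGROUND `U₀ = 1` is FALSE at every finite
# Dirichlet region with an exposed corner, in particular at the cube member `cubeFam false` — so `prop6_exists_cubeMember_at₃` (g2),
# `prop6_cubeMember_flat_of_real` (g4) and their descendants are VACUOUS at `U₀ = 1` as typed (a located typing defect; print is consistent)

statement-level skeleton of published theorems with citation tags; proofs where landed; nothing here is a claim about the
Yang–Mills mass gap

`[Balaban1985RegularSpaces]` ("B8", CMP **99** (1985) 75–102) (1.59) p. 86, Thm 4 p. 88 ((1.68)–(1.69)), (1.29) p. 81, (1.36)–(1.38) p. 82, p. 77 (bond ∕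
plaquette conventions), p. 86 (norms «sup_j sup_{Ω_j}»), Prop. 6 p. 99 (family (T, □₁, …, □_k): «we admit the case where some domains Ω_j are
equal to T_η», p. 77); [4] = `[Balaban1985BackgroundPropagators]` Thm 3.3 p. 399; [B7] = `[Balaban1985Averaging]` (43) p. 24 (locality of the
averages).  PDF held: `paper:balaban1985-cmp99-regular-spaces-gauge-fixing` (journal page = PDF page + 74).

CITATION HEADER (lean-in-tree rule).  Cell `pub-ymgap` (YM Track A, HUMAN RULING D-0062), DAG node N05 = [B8], seat `pub-ymgap-dag-n05-e` (g5;
director-ym R141 (C), FAN-OUT §N05 row s3b).  Companion of `B8Ineq159FlatCornerDefect` (the SCALAR certificate; its witness machinery is reused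
BY NAME).  The `𝔸`-valued clause reaches the same uncontrolled pure-gauge mode through its FREE binder `u`: the socket quantifies over every
unitary `u` with (1.29) `Restr129 L m Λs U₀ u` — which reads `u` only inside the tower boxes of the restriction sites ([B7] p. 24;
`B8Ineq172Concrete.uavg_congr_tower`) — and `mgauge U₀ u W = U′`; at `(U₀, U′) = (1, 1)` the unitary bump `u = e^{iηa}` at the far corner
`z₀ = c + e_{i₁} + e_{i₂}` (`a = t·1`, `t = c⋆(L^mη)⁻¹/2`) passes (1.29), its pure gauge `W = u⁻¹u(·+e)` is `1` on every bond touching `Ω₀`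
(Landau gauge of `1` by locality, `isLandau138W_congr` + `isLandau138W_one`) and `e^{iηa}` exactly on the outer sides `s₁, s₂` of the corner
plaquette (`collar_bond_at_corner`: the collar bonds at `z₀` are `s₁, s₂`); `A′ = a` on `s₁, s₂`, `0` elsewhere meets every binder, the right
side is `0` (companion §2–§3) and the left side `≥ η‖a‖ > 0`.  ★ `h59_body_false_of_corner` (generic data, every C⋆-algebra, every `c⋆ > 0`,
`B₀`); `cutFixed_one`; ★ `h59₁_false_at_one_cubeMember`: the `H59₁` display of `B8Prop6CubeMemberFlat3` ∕ `B8Prop6CubeMemberFlatScalar` at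
`U₀ = 1` is false (truncation `m = 1`, corner `sqHi … 0`) ⇒ those Prop.-6-at-`{□_j}` theorems (`cubeFam false`) are vacuous at `U₀ = 1` as
typed; the repair belongs to the socket owner (LHS over `BondTouches (Ω j)` = print's norm, or the family `cubeFam true`, `Ω₀ = T`).

HONEST SCOPE.  A negative typing certificate with explicit witnesses; nothing of [4] ∕ [Balaban1985RegularSpaces] is proved or refuted
(print's norms are suprema over the bonds OF `Ω_j`, and its Prop.-6 family has `Ω₀ = T`); count-neutral; N05 NOT discharged; SECOND-GAP:
none; one finite `T⁴` programme at fixed `ε`, Bałaban as printed; nothing continuum ∕ ℝ⁴ ∕ OS ∕ mass-gap ∕ Clay.  No `sorry`, no `def`, no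
`instance`, no `notation`.  Unit `pub-ymgap-dag-n05-e` (g5), 2026-08-27.
-/

noncomputable section

namespace Literature.MathematicalPhysics.QuantumFieldTheory.Balaban1983to89.B8SockH59CornerDefect

open NormedSpace
open Complex (I)
open B7Prop1Explicit (e e_apply expUnit val_expUnit gaugeAct)
open B7Prop2Explicit (unitaryUnits)
open B7Eq92Concrete (mgauge mgauge_apply)
open B7Eq78Linearization (Rbar_one zdBlocking)
open B8Eq119TwistedAxial (Restr129 bgT towerGauge_one)
open B8Eq184Proof (cfgExp)
open B7Prop1Local (InBox loK bondHiK clampCfg)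
open B8Ineq132 (covDerivFwd BondTouches)
open B8Eq146AExpansion (iEta)
open B8Eq155JBound (Jcur wsup wsup_le wsup_nonneg)
open B8ScaledSupNorm (weight msup Bdd bondNorm msup_le msup_nonneg weight_mul_norm_le_msup weight_neg_natCast)
open B8Eq138LandauZd (IsLandau138W isLandau138W_congr isLandau138W_one)
open B8Eq140Level (SideTouches)
open B7Prop4GeneralLevels (linCovIter)
open B7Prop5Flat (bump BondIn linQIter_add linQIter_bump_eq_zero)
open B9Eq316TowerFlatIsOneStep (linCovIter_one_left)
open B8Eq131Cubes (sqLo sqHi bLo bHi gs one_le_gs cube tLo tHi ctr)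
open B8Eq131CubesAdmissible (cubeFam cubeFam_false_of_le)
open B8CubeMemberZd (cubeLamS cubeLamB hbox_cubeLamB)
open B8Eq191FlatLettersCubeMember (cubeFam_subset_zero)
open B8Ineq130 (tlo thi tlo_zero thi_zero gaugeAct_one)
open B8Ineq133 (cutFixed cutCfg)
open B8Eq115GaugeFixing (localGauge towerGauge)
open B8SockHFPCubeMember (htw_cubeLamS)
open B8Ineq159FlatCornerDefect (corner_key wit_eq_zero_of norm_wit_le wit_apply_s₁ wit_apply_s₂ Jcur_wit_eq_zero)

export B7Prop1Explicit (Site)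

variable {d : ℕ}

/-! ## ★ The `𝔸`-valued (1.59) clause `H59₁` ∕ `SockH59` at background `1` is false at every finite region with an exposed corner -/

section Sock

variable {𝔸 : Type*} [CStarAlgebra 𝔸] [Nontrivial 𝔸]

/-- **The collar bonds incident to the far corner `z₀ = c + e_{i₁} + e_{i₂}` are exactly the two outer sides of the corner plaquette**:
if `(y, τ)` is a side of a plaquette touching `Ω₀ ⊂ {x : x_{i₁} ≤ c_{i₁}, x_{i₂} ≤ c_{i₂}}` and `y = z₀` or `y + e_τ = z₀`, then
`(y, τ) = s₁` or `s₂`. [cite: Balaban1985RegularSpaces, p.77 (bond ∕ plaquette conventions)] -/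
theorem collar_bond_at_corner {i₁ i₂ : Fin d} (hne : i₁ ≠ i₂) (c : Site d) {Ω₀ : Set (Site d)}
    (hmax : ∀ x ∈ Ω₀, x i₁ ≤ c i₁ ∧ x i₂ ≤ c i₂) {y : Site d} {τ : Fin d} (hs : SideTouches Ω₀ y τ)
    (hend : y = c + e i₁ + e i₂ ∨ y + e τ = c + e i₁ + e i₂) :
    (y = c + e i₁ ∧ τ = i₂) ∨ (y = c + e i₂ ∧ τ = i₁) := by
  obtain ⟨z, κ, ν, hκν, hP, hS⟩ := hs
  -- a corner of the plaquette in the quadrant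
  obtain ⟨q, hq, hq1, hq2⟩ : ∃ q, (q = z ∨ q = z + e κ ∨ q = z + e ν ∨ q = z + e κ + e ν) ∧ q i₁ ≤ c i₁ ∧ q i₂ ≤ c i₂ := by
    rcases hP with h | h | h | h
    · exact ⟨z, Or.inl rfl, hmax _ h⟩
    · exact ⟨z + e κ, Or.inr (Or.inl rfl), hmax _ h⟩
    · exact ⟨z + e ν, Or.inr (Or.inr (Or.inl rfl)), hmax _ h⟩
    · exact ⟨z + e κ + e ν, Or.inr (Or.inr (Or.inr rfl)), hmax _ h⟩
  -- `z₀` is a corner (an end-point of the side)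
  have hz0 : c + e i₁ + e i₂ = z ∨ c + e i₁ + e i₂ = z + e κ ∨ c + e i₁ + e i₂ = z + e ν ∨ c + e i₁ + e i₂ = z + e κ + e ν := by
    rcases hS with ⟨hy, hτ⟩ | ⟨hy, hτ⟩ | ⟨hy, hτ⟩ | ⟨hy, hτ⟩ <;> rw [hy, hτ] at hend <;> rcases hend with h | h
    · exact Or.inl h.symm
    · exact Or.inr (Or.inl h.symm)
    · exact Or.inr (Or.inl h.symm)
    · exact Or.inr (Or.inr (Or.inr h.symm))
    · exact Or.inr (Or.inr (Or.inl h.symm))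
    · refine Or.inr (Or.inr (Or.inr ?_)); rw [← h, add_assoc, add_comm (e ν), ← add_assoc]
    · exact Or.inl h.symm
    · exact Or.inr (Or.inr (Or.inl h.symm))
  obtain ⟨hzc, hdir⟩ := corner_key hne c z q hκν hq hq1 hq2 hz0
  -- coordinates of the candidate end-points
  have hz1 : (c + e i₁ + e i₂) i₁ = c i₁ + 1 := by simp [e_apply, hne]
  have hz2 : (c + e i₁ + e i₂) i₂ = c i₂ + 1 := by simp [e_apply, hne.symm]
  have hc0 : c ≠ c + e i₁ + e i₂ := fun h => by have := congrFun h i₁; rw [hz1] at this; omega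
  have hc1 : c + e i₁ ≠ c + e i₁ + e i₂ := fun h => by
    have := congrFun h i₂; rw [hz2] at this; simp [e_apply, hne.symm] at this
  have hc2 : c + e i₂ ≠ c + e i₁ + e i₂ := fun h => by
    have := congrFun h i₁; rw [hz1] at this; simp [e_apply, hne] at this
  have hc12 : c + e i₂ + e i₁ = c + e i₁ + e i₂ := by rw [add_assoc, add_comm (e i₂), ← add_assoc]
  rw [hzc] at hS
  rcases hdir with ⟨hκ, hν⟩ | ⟨hκ, hν⟩ <;> rw [hκ, hν] at hS <;>
    rcases hS with ⟨hy, hτ⟩ | ⟨hy, hτ⟩ | ⟨hy, hτ⟩ | ⟨hy, hτ⟩ <;> rw [hy, hτ] at hend ⊢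
  · exact absurd (hend.resolve_left hc0) hc1
  · exact Or.inl ⟨rfl, rfl⟩
  · exact Or.inr ⟨rfl, rfl⟩
  · exact absurd (hend.resolve_left hc0) hc2
  · exact absurd (hend.resolve_left hc0) hc2
  · exact Or.inr ⟨rfl, rfl⟩
  · exact Or.inl ⟨rfl, rfl⟩
  · exact absurd (hend.resolve_left hc0) hc1

/-- ★ **THE `𝔸`-VALUED (1.59) CLAUSE OF THE N05 SOCKET FAMILY AT BACKGROUND `1` IS FALSE AT EVERY REGION WITH AN EXPOSED CORNER** — the
body of `B8LeafModelZd.SockH59` ∕ `H59₁` at `U₀ = 1`, `U′ = 1` (binders `u, W, A′`: `u` unitary, `mgauge 1 u W = 1`, `Restr129 L m Λs 1 u`,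
`IsLandau138W L m η (Ω 0) Λs 1 W`, `A′` self-adjoint, `W = e^{iηA′}` ∧ `‖A′‖ ≤ c⋆(Lʲη)⁻¹` on the collars, `A′ = 0` off them ⇒ the two members),
for every `c⋆ > 0`, `B₀`, at domain data with an exposed corner `c` ((i)–(iv) of the scalar certificate + (v) the tower boxes of `Λs j` lie in
`Ω 0`).  Witness: the bump `u = e^{iηa}` at `z₀`, `W = u⁻¹u(·+e)`, `A′ = a(δ_{s₁} + δ_{s₂})` (module docstring).
[cite: Balaban1985RegularSpaces, (1.59) p.86, Thm 4 p.88 ((1.68)–(1.69)), (1.29) p.81, (1.38) p.82, p.77; Balaban1985BackgroundPropagators, Thm 3.3 p.399] -/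
theorem h59_body_false_of_corner {i₁ i₂ : Fin d} (hne : i₁ ≠ i₂) {L : ℕ} (hL : 1 ≤ L) {η : ℝ} (hη : 0 < η) (m : ℕ)
    (Ω : ℕ → Set (Site d)) (Λs : ℕ → Set (Site d)) (Λb : ℕ → Set (Site d × Fin d)) (B₀ : ℝ) {cst : ℝ} (hcst : 0 < cst)
    (c : Site d) (hc : c ∈ Ω 0) (hmax : ∀ x ∈ Ω 0, x i₁ ≤ c i₁ ∧ x i₂ ≤ c i₂) (hΩ0 : ∀ j, j ≤ m → Ω j ⊆ Ω 0)
    (hbox : ∀ j, j ≤ m → ∀ q ∈ Λb j, ∀ x, InBox (loK L j q.1) (bondHiK L j q.1 q.2) x → x ∈ Ω 0)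
    (htw : ∀ j, j ≤ m → ∀ y ∈ Λs j, ∀ x, InBox (tlo L y j) (thi L y j) x → x ∈ Ω 0) :
    ¬ (∀ (u : Site d → 𝔸ˣ) (W : Site d → Fin d → 𝔸ˣ) (A' : Site d → Fin d → 𝔸),
      (∀ x, u x ∈ unitaryUnits 𝔸) → mgauge (1 : Site d → Fin d → 𝔸ˣ) u W = 1 → Restr129 L m Λs (1 : Site d → Fin d → 𝔸ˣ) u →
      IsLandau138W L m η (Ω 0) Λs (1 : Site d → Fin d → 𝔸ˣ) W →
      (∀ y τ, IsSelfAdjoint (A' y τ)) →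
      (∀ j, j ≤ m → ∀ (y : Site d) (τ : Fin d), SideTouches (Ω j) y τ →
        W y τ = cfgExp η A' y τ ∧ ‖A' y τ‖ ≤ cst * ((L : ℝ) ^ j * η)⁻¹) →
      (∀ (y : Site d) (τ : Fin d), (∀ j, j ≤ m → ¬ SideTouches (Ω j) y τ) → A' y τ = 0) →
      msup L m η (-(1 : ℝ)) (fun j (b : Site d × Fin d) => SideTouches (Ω j) b.1 b.2) (fun b => A' b.1 b.2)
          ≤ B₀ * (bondNorm L m η (-(3 : ℝ)) Ω (fun x μ => Jcur η (1 : Site d → Fin d → 𝔸ˣ) A' μ x)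
            + wsup 1 (fun p : {p : ℕ × (Site d × Fin d) // p.1 ≤ m ∧ p.2 ∈ Λb p.1} =>
                linCovIter L (1 : Site d → Fin d → 𝔸ˣ) (iEta η A') p.1.1 p.1.2.1 p.1.2.2)) ∧
        msup L m η (-(2 : ℝ)) (fun j (t : Fin d × Fin d × Site d) => SideTouches (Ω j) t.2.2 t.2.1)
            (fun t => covDerivFwd η (1 : Site d → Fin d → 𝔸ˣ) t.1 (fun z => A' z t.2.1) t.2.2)
          ≤ B₀ * (bondNorm L m η (-(3 : ℝ)) Ω (fun x μ => Jcur η (1 : Site d → Fin d → 𝔸ˣ) A' μ x)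
            + wsup 1 (fun p : {p : ℕ × (Site d × Fin d) // p.1 ≤ m ∧ p.2 ∈ Λb p.1} =>
                linCovIter L (1 : Site d → Fin d → 𝔸ˣ) (iEta η A') p.1.1 p.1.2.1 p.1.2.2))) := by
  intro H
  have hL1 : (1 : ℝ) ≤ L := by exact_mod_cast hL
  -- coordinates of the corner data
  have hz1 : (c + e i₁ + e i₂) i₁ = c i₁ + 1 := by simp [e_apply, hne]
  have hz2 : (c + e i₁ + e i₂) i₂ = c i₂ + 1 := by simp [e_apply, hne.symm]
  have hs11 : (c + e i₁) i₁ = c i₁ + 1 := by simp [e_apply]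
  have hs22 : (c + e i₂) i₂ = c i₂ + 1 := by simp [e_apply]
  have hquad : ∀ x : Site d, x i₁ ≤ c i₁ ∧ x i₂ ≤ c i₂ → x ≠ c + e i₁ + e i₂ := fun x hx h => by
    have := congrFun h i₁; rw [hz1] at this; omega
  have hquad' : ∀ (x : Site d) (κ : Fin d), x i₁ ≤ c i₁ ∧ x i₂ ≤ c i₂ → x ≠ c + e i₁ + e i₂ - e κ := fun x κ hx h => by
    have h1 := congrFun h i₁; have h2 := congrFun h i₂
    simp only [Pi.sub_apply, hz1, hz2, e_apply] at h1 h2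
    by_cases hκ1 : i₁ = κ
    · rw [if_neg (fun h' => hne (hκ1.trans h'.symm))] at h2; omega
    · rw [if_neg hκ1] at h1; omega
  have hout0 : c + e i₁ + e i₂ ∉ Ω 0 := fun h => hquad _ (hmax _ h) rfl
  have hout1 : c + e i₁ ∉ Ω 0 := fun h => by have := (hmax _ h).1; rw [hs11] at this; omega
  have hout2 : c + e i₂ ∉ Ω 0 := fun h => by have := (hmax _ h).2; rw [hs22] at this; omega
  have hne1 : c + e i₁ ≠ c + e i₁ + e i₂ := fun h => by
    have := congrFun h i₂; rw [hz2] at this; simp [e_apply, hne.symm] at this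
  have hne2 : c + e i₂ ≠ c + e i₁ + e i₂ := fun h => by
    have := congrFun h i₁; rw [hz1] at this; simp [e_apply, hne] at this
  have hc12 : c + e i₂ + e i₁ = c + e i₁ + e i₂ := by rw [add_assoc, add_comm (e i₂), ← add_assoc]
  -- THE WITNESS: the Lie-algebra element `a = t·1`, the bump `u`, the pure gauge `W`, the exponent `A′`
  obtain ⟨t, ht⟩ : ∃ t : ℝ, t = cst * ((L : ℝ) ^ m * η)⁻¹ / 2 := ⟨_, rfl⟩
  have ht0 : 0 < t := by rw [ht]; positivity
  obtain ⟨a, ha⟩ : ∃ a : 𝔸, a = ((t : ℝ) : ℂ) • (1 : 𝔸) := ⟨_, rfl⟩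
  have ha_sa : IsSelfAdjoint a := by rw [ha]; exact B8Eq155JBound.isSelfAdjoint_real_smul t (IsSelfAdjoint.one 𝔸)
  have ha_norm : ‖a‖ = t := by rw [ha, norm_smul, Complex.norm_real, Real.norm_of_nonneg ht0.le, norm_one, mul_one]
  obtain ⟨g₀, hg₀⟩ : ∃ g₀ : 𝔸ˣ, g₀ = expUnit ((I : ℂ) • (η • a)) := ⟨_, rfl⟩
  have hg₀u : g₀ ∈ unitaryUnits 𝔸 := by
    rw [B7Prop2Explicit.mem_unitaryUnits, hg₀, val_expUnit]
    exact B8Ineq170.exp_I_smul_mem_unitary (B8Prop5Reality.isSelfAdjoint_real_smul η ha_sa)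
  obtain ⟨u, hu⟩ : ∃ u : Site d → 𝔸ˣ, u = fun x => if x = c + e i₁ + e i₂ then g₀ else 1 := ⟨_, rfl⟩
  have hu1 : ∀ x, x ≠ c + e i₁ + e i₂ → u x = 1 := fun x hx => by rw [hu]; exact if_neg hx
  have huz : u (c + e i₁ + e i₂) = g₀ := by rw [hu]; exact if_pos rfl
  obtain ⟨W, hW⟩ : ∃ W : Site d → Fin d → 𝔸ˣ, W = fun x κ => (u x)⁻¹ * u (x + e κ) := ⟨_, rfl⟩
  have hW1 : ∀ (x : Site d) (κ : Fin d), x ≠ c + e i₁ + e i₂ → x + e κ ≠ c + e i₁ + e i₂ → W x κ = 1 := by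
    intro x κ h1 h2; rw [hW]; simp only [hu1 x h1, hu1 _ h2, inv_one, one_mul]
  have hWs1 : W (c + e i₁) i₂ = g₀ := by rw [hW]; simp only [hu1 _ hne1, huz, inv_one, one_mul]
  have hWs2 : W (c + e i₂) i₁ = g₀ := by rw [hW]; simp only [hu1 _ hne2, hc12, huz, inv_one, one_mul]
  obtain ⟨A', hA'⟩ : ∃ A' : Site d → Fin d → 𝔸, A' = bump (c + e i₁) i₂ a + bump (c + e i₂) i₁ a := ⟨_, rfl⟩
  -- (1) `u` unitary
  have h1 : ∀ x, u x ∈ unitaryUnits 𝔸 := by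
    intro x; rw [hu]; simp only
    split_ifs
    · exact hg₀u
    · exact (unitaryUnits 𝔸).one_mem
  -- (2) `mgauge 1 u W = 1`
  have h2 : mgauge (1 : Site d → Fin d → 𝔸ˣ) u W = 1 := by
    funext x κ
    rw [mgauge_apply, hW]
    simp only [Pi.one_apply, B7Eq92Concrete.Rc_one_apply]
    group
  -- (3) (1.29): the averages read `u` only inside the tower boxes, where `u = 1`
  have h3 : Restr129 L m Λs (1 : Site d → Fin d → 𝔸ˣ) u := by
    intro j hj y hy
    have hbox1 : ∀ x : Site d, tlo L y j ≤ x → x ≤ thi L y j → u x = (1 : Site d → 𝔸ˣ) x := fun x hx hx' =>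
      hu1 x (hquad x (hmax x (htw j hj y hy x fun i => ⟨hx i, hx' i⟩)))
    have hcongr := B8Ineq172Concrete.uavg_congr_tower (U₀ := (1 : Site d → Fin d → 𝔸ˣ)) (U₀' := (1 : Site d → Fin d → 𝔸ˣ))
      (y := y) (j := j) hL (fun _ _ _ _ => rfl) hbox1 j 0 (by omega) y (by rw [tlo_zero]) (by rw [thi_zero])
    have hval := congrFun (B8Eq178Averages.rbar_bgT_eq_uavg L (1 : Site d → Fin d → 𝔸ˣ) u j) y
    have hone := congrFun (B8Eq178Averages.rbar_bgT_eq_uavg L (1 : Site d → Fin d → 𝔸ˣ) (1 : Site d → 𝔸ˣ) j) y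
    have hR1 := congrFun (Rbar_one (zdBlocking d L) (bgT L (1 : Site d → Fin d → 𝔸ˣ)) j) y
    rw [hval, hcongr, ← hone]
    have hfun : (fun x : Site d => (((1 : Site d → 𝔸ˣ) x : 𝔸ˣ) : 𝔸)) = fun _ => (1 : 𝔸) := by
      funext x; simp
    rw [hfun, hR1]
  -- (4) `W` is in the Landau gauge (1.38) of `1`: it IS `1` on every bond touching `Ω 0`
  have h4 : IsLandau138W L m η (Ω 0) Λs (1 : Site d → Fin d → 𝔸ˣ) W := by
    have hWB : ∀ (x : Site d) (μ : Fin d), BondTouches (Ω 0) x μ → W x μ = (1 : Site d → Fin d → 𝔸ˣ) x μ := by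
      intro x μ hb
      rw [Pi.one_apply]  -- `(1 : Site d → Fin d → 𝔸ˣ) x μ = 1`
      refine hW1 x μ ?_ ?_
      · rcases hb with h | h
        · exact hquad x (hmax x h)
        · intro hx
          have := hmax _ h
          rw [hx] at this
          have h1 := this.1; simp only [Pi.add_apply, hz1, e_apply] at h1; split_ifs at h1 <;> omega
      · rcases hb with h | h
        · intro hx
          exact hquad' x μ (hmax x h) (by rw [← hx, add_sub_cancel_right])
        · exact hquad _ (hmax _ h)
    exact (isLandau138W_congr η L (1 : Site d → Fin d → 𝔸ˣ) hWB).mpr (isLandau138W_one η L _ m (Ω 0) Λs)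
  -- (5) `A′` self-adjoint
  have h5 : ∀ (y : Site d) (τ : Fin d), IsSelfAdjoint (A' y τ) := by
    intro y τ
    rw [hA']
    simp only [Pi.add_apply, bump]
    split_ifs
    · exact ha_sa.add ha_sa
    · rw [add_zero]; exact ha_sa
    · rw [zero_add]; exact ha_sa
    · rw [add_zero]; exact IsSelfAdjoint.zero 𝔸
  -- (6) `W = e^{iηA′}` and the exponent bound on the collars
  have hside1 : SideTouches (Ω 0) (c + e i₁) i₂ := ⟨c, i₁, i₂, hne, Or.inl hc, Or.inr (Or.inl ⟨rfl, rfl⟩)⟩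
  have hside2 : SideTouches (Ω 0) (c + e i₂) i₁ := ⟨c, i₁, i₂, hne, Or.inl hc, Or.inr (Or.inr (Or.inl ⟨rfl, rfl⟩))⟩
  have hinvle : ∀ j, j ≤ m → cst * ((L : ℝ) ^ m * η)⁻¹ / 2 ≤ cst * ((L : ℝ) ^ j * η)⁻¹ := by
    intro j hj
    have h0 : 0 < (L : ℝ) ^ j * η := by positivity
    have hle : ((L : ℝ) ^ m * η)⁻¹ ≤ ((L : ℝ) ^ j * η)⁻¹ :=
      inv_anti₀ h0 (mul_le_mul_of_nonneg_right (pow_le_pow_right₀ hL1 hj) hη.le)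
    have h3 : 0 ≤ cst * ((L : ℝ) ^ j * η)⁻¹ := by positivity
    nlinarith [mul_le_mul_of_nonneg_left hle hcst.le]
  have h6 : ∀ j, j ≤ m → ∀ (y : Site d) (τ : Fin d), SideTouches (Ω j) y τ →
      W y τ = cfgExp η A' y τ ∧ ‖A' y τ‖ ≤ cst * ((L : ℝ) ^ j * η)⁻¹ := by
    intro j hj y τ hsj
    have hs0 : SideTouches (Ω 0) y τ := B8Eq140Level.sideTouches_mono (hΩ0 j hj) hsj
    by_cases hb : (y = c + e i₁ ∧ τ = i₂) ∨ (y = c + e i₂ ∧ τ = i₁)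
    · have hval : A' y τ = a := by
        rcases hb with ⟨hy, hτ⟩ | ⟨hy, hτ⟩
        · rw [hA', hy, hτ]; exact wit_apply_s₁ hne c a
        · rw [hA', hy, hτ]; exact wit_apply_s₂ hne c a
      refine ⟨?_, ?_⟩
      · have hWv : W y τ = g₀ := by
          rcases hb with ⟨hy, hτ⟩ | ⟨hy, hτ⟩
          · rw [hy, hτ]; exact hWs1
          · rw [hy, hτ]; exact hWs2
        rw [hWv, hg₀]
        exact Units.ext (by rw [val_expUnit, cfgExp, val_expUnit, hval])
      · rw [hval, ha_norm, ht]; exact hinvle j hj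
    · have hval : A' y τ = 0 := by rw [hA']; exact wit_eq_zero_of c i₁ i₂ a hb
      refine ⟨?_, ?_⟩
      · have hy : y ≠ c + e i₁ + e i₂ := fun h => hb (collar_bond_at_corner hne c hmax hs0 (Or.inl h))
        have hyτ : y + e τ ≠ c + e i₁ + e i₂ := fun h => hb (collar_bond_at_corner hne c hmax hs0 (Or.inr h))
        rw [hW1 y τ hy hyτ]
        exact Units.ext (by rw [cfgExp, val_expUnit, hval, smul_zero, smul_zero, NormedSpace.exp_zero, Units.val_one])
      · rw [hval, norm_zero]; positivity
  -- (7) `A′` vanishes off the collars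
  have h7 : ∀ (y : Site d) (τ : Fin d), (∀ j, j ≤ m → ¬ SideTouches (Ω j) y τ) → A' y τ = 0 := by
    intro y τ h
    rw [hA']
    refine wit_eq_zero_of c i₁ i₂ a ?_
    rintro (⟨rfl, rfl⟩ | ⟨rfl, rfl⟩)
    · exact h 0 (Nat.zero_le _) hside1
    · exact h 0 (Nat.zero_le _) hside2
  obtain ⟨hmem, -⟩ := H u W A' h1 h2 h3 h4 h5 h6 h7
  -- (8) the right side vanishes
  have hJ : bondNorm L m η (-(3 : ℝ)) Ω (fun x μ => Jcur η (1 : Site d → Fin d → 𝔸ˣ) A' μ x) = 0 := by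
    refine le_antisymm (msup_le le_rfl fun j hj b hb => ?_) (msup_nonneg L m hη.le _ _ _)
    have hq : (b.1 i₁ ≤ c i₁ ∧ b.1 i₂ ≤ c i₂) ∨ ((b.1 + e b.2) i₁ ≤ c i₁ ∧ (b.1 + e b.2) i₂ ≤ c i₂) := by
      rcases hb with h | h
      · exact Or.inl (hmax _ (hΩ0 j hj h))
      · exact Or.inr (hmax _ (hΩ0 j hj h))
    have hz : Jcur η (1 : Site d → Fin d → 𝔸ˣ) A' b.2 b.1 = 0 := by rw [hA']; exact Jcur_wit_eq_zero hne η c a hq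
    simp only [hz, norm_zero, mul_zero, le_refl]
  have hiEta : iEta η A' = bump (c + e i₁) i₂ (((I : ℂ) * η) • a) + bump (c + e i₂) i₁ (((I : ℂ) * η) • a) := by
    funext y τ
    rw [hA']
    simp only [iEta, Pi.add_apply, bump, smul_add]
    split_ifs <;> simp
  have hvbd : ∀ (y : Site d) (τ : Fin d), ‖iEta η A' y τ‖ ≤ ‖((I : ℂ) * η) • a‖ + ‖((I : ℂ) * η) • a‖ := fun y τ => by
    rw [hiEta]; exact norm_wit_le c i₁ i₂ _ y τ
  have hQ : wsup 1 (fun p : {p : ℕ × (Site d × Fin d) // p.1 ≤ m ∧ p.2 ∈ Λb p.1} =>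
      linCovIter L (1 : Site d → Fin d → 𝔸ˣ) (iEta η A') p.1.1 p.1.2.1 p.1.2.2) = 0 := by
    refine le_antisymm (wsup_le (fun p => ?_) le_rfl) (wsup_nonneg zero_le_one _)
    have hB : ∀ (y : Site d) (τ : Fin d), (y = c + e i₁ ∨ y = c + e i₂) →
        ¬ BondIn (loK L p.1.1 p.1.2.1) (bondHiK L p.1.1 p.1.2.1 p.1.2.2) y τ := by
      rintro y τ (rfl | rfl) ⟨hin, -⟩
      · exact hout1 (hbox p.1.1 p.2.1 p.1.2 p.2.2 _ hin)
      · exact hout2 (hbox p.1.1 p.2.1 p.1.2 p.2.2 _ hin)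
    rw [linCovIter_one_left L hL _ (by positivity) hvbd p.1.1, hiEta, linQIter_add,
      linQIter_bump_eq_zero L _ _ _ _ _ _ (hB _ _ (Or.inl rfl)), linQIter_bump_eq_zero L _ _ _ _ _ _ (hB _ _ (Or.inr rfl)),
      add_zero, norm_zero, mul_zero]
  rw [hJ, hQ, add_zero, mul_zero] at hmem
  -- (9) the left side is at least `η‖a‖ = ηt > 0`
  have hBdd : Bdd L m η (-(1 : ℝ)) (fun j (b : Site d × Fin d) => SideTouches (Ω j) b.1 b.2) (fun b => A' b.1 b.2) := by
    refine ⟨(L : ℝ) ^ m * η * (‖a‖ + ‖a‖), fun j hj b _ => ?_⟩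
    have hw : weight L η (-(1 : ℝ)) j = (L : ℝ) ^ j * η := by simpa using weight_neg_natCast L η 1 j
    rw [hw]
    have hvb : ‖A' b.1 b.2‖ ≤ ‖a‖ + ‖a‖ := by rw [hA']; exact norm_wit_le c i₁ i₂ a b.1 b.2
    exact mul_le_mul (mul_le_mul_of_nonneg_right (pow_le_pow_right₀ hL1 hj) hη.le) hvb (norm_nonneg _) (by positivity)
  have hlow := weight_mul_norm_le_msup hBdd (Nat.zero_le m) (i := (c + e i₁, i₂)) hside1
  have hw0 : weight L η (-(1 : ℝ)) 0 = η := by simpa using weight_neg_natCast L η 1 0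
  have hval : ‖A' (c + e i₁) i₂‖ = t := by rw [hA', wit_apply_s₁ hne c a, ha_norm]
  rw [hw0, hval] at hlow
  have : 0 < η * t := mul_pos hη ht0
  linarith


omit [Nontrivial 𝔸] in
/-- At the trivial background the cut gauge-fixed configuration `U₀″` of p. 99 is trivial: `cutFixed … 1 … = 1` (the clamped extension of
`1` is `1`, its tower gauge is `1`, `1^{1} = 1`, and the cut-off of `1` is `1`). [cite: Balaban1985RegularSpaces, p.99 (definition of U₀″)] -/
theorem cutFixed_one (L : ℕ) (lo hi : Site d) (k : ℕ) (y : Site d) :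
    cutFixed L lo hi (1 : Site d → Fin d → 𝔸ˣ) k y = 1 := by
  have hcl : clampCfg (tlo L lo k) (thi L hi k) (1 : Site d → Fin d → 𝔸ˣ) = 1 := by
    funext x κ; unfold clampCfg; split_ifs <;> rfl
  show cutCfg (tlo L lo k) (thi L hi k) (gaugeAct (towerGauge L (clampCfg (tlo L lo k) (thi L hi k) 1) k y) 1) = 1
  rw [hcl, towerGauge_one, gaugeAct_one]
  funext x κ; unfold cutCfg; split_ifs <;> rfl

/-- ★ **`H59₁` AT `U₀ = 1` IS FALSE AT THE CONCRETE CUBE MEMBER `{□_j}` OF (1.131)** — the (1.59) hypothesis displayed by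
`B8Prop6CubeMemberFlat3.prop6_exists_cubeMember_at₃` ∕ `B8Prop6CubeMemberFlatScalar.prop6_cubeMember_flat_of_real` at the trivial background
(`U₀″ = cutFixed … 1 … = 1`), ANY exponent constant `c⋆ > 0`, ANY `B₀`, `d ≥ 2`, `1 ≤ L ≤ ρ`, `η > 0`, `k ≥ 1`: refuted at `m = 1` by
`h59_body_false_of_corner` at the corner `sqHi … 0` of `□₀` — those theorems are VACUOUS at `U₀ = 1` as typed (count-neutral typing defect;
print's Prop. 6 family has `Ω₀ = T`). [cite: Balaban1985RegularSpaces, (1.59) p.86, Thm 4 p.88, Prop. 6 p.99, (1.131) p.99, p.77] -/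
theorem h59₁_false_at_one_cubeMember (hd2 : 2 ≤ d) {L : ℕ} (hL : 1 ≤ L) {η : ℝ} (hη : 0 < η) (a : Site d) (M : ℕ) {ρ : ℕ}
    (hρ : L ≤ ρ) {k : ℕ} (hk : 1 ≤ k) (B₀ : ℝ) {cst : ℝ} (hcst : 0 < cst) :
    ¬ (∀ m, 1 ≤ m → m ≤ k → ∀ (u : Site d → 𝔸ˣ) (W : Site d → Fin d → 𝔸ˣ) (A' : Site d → Fin d → 𝔸),
        (∀ x, u x ∈ unitaryUnits 𝔸) →
          mgauge (1 : Site d → Fin d → 𝔸ˣ) u W = cutFixed L (tLo a ρ) (tHi a M ρ) (1 : Site d → Fin d → 𝔸ˣ) k (ctr a M) →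
          Restr129 L m ((cubeLamS L a M ρ k) m) (1 : Site d → Fin d → 𝔸ˣ) u →
          IsLandau138W L m η ((cubeFam false L a M ρ k) 0) ((cubeLamS L a M ρ k) m) (1 : Site d → Fin d → 𝔸ˣ) W →
        (∀ y τ, IsSelfAdjoint (A' y τ)) →
        (∀ j, j ≤ m → ∀ y τ, SideTouches ((cubeFam false L a M ρ k) j) y τ →
          W y τ = cfgExp η A' y τ ∧ ‖A' y τ‖ ≤ cst * ((L : ℝ) ^ j * η)⁻¹) →
        (∀ y τ, (∀ j, j ≤ m → ¬ SideTouches ((cubeFam false L a M ρ k) j) y τ) → A' y τ = 0) →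
        msup L m η (-(1 : ℝ)) (fun j (b : Site d × Fin d) => SideTouches ((cubeFam false L a M ρ k) j) b.1 b.2) (fun b => A' b.1 b.2)
        ≤ B₀ * (bondNorm L m η (-(3 : ℝ)) (cubeFam false L a M ρ k) (fun x μ => Jcur η (1 : Site d → Fin d → 𝔸ˣ) A' μ x)
        + wsup 1 (fun p : {p : ℕ × (Site d × Fin d) // p.1 ≤ m ∧ p.2 ∈ (cubeLamB L a M ρ k) m p.1} =>
        linCovIter L (1 : Site d → Fin d → 𝔸ˣ) (iEta η A') p.1.1 p.1.2.1 p.1.2.2)) ∧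
        msup L m η (-(2 : ℝ)) (fun j (t : Fin d × Fin d × Site d) => SideTouches ((cubeFam false L a M ρ k) j) t.2.2 t.2.1)
        (fun t => covDerivFwd η (1 : Site d → Fin d → 𝔸ˣ) t.1 (fun z => A' z t.2.1) t.2.2)
        ≤ B₀ * (bondNorm L m η (-(3 : ℝ)) (cubeFam false L a M ρ k) (fun x μ => Jcur η (1 : Site d → Fin d → 𝔸ˣ) A' μ x)
        + wsup 1 (fun p : {p : ℕ × (Site d × Fin d) // p.1 ≤ m ∧ p.2 ∈ (cubeLamB L a M ρ k) m p.1} =>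
        linCovIter L (1 : Site d → Fin d → 𝔸ˣ) (iEta η A') p.1.1 p.1.2.1 p.1.2.2))) := by
  intro H
  -- two directions and the exposed corner `hi` of `□₀`
  obtain ⟨i₁, hi₁⟩ : ∃ i₁ : Fin d, i₁ = ⟨0, by omega⟩ := ⟨_, rfl⟩
  obtain ⟨i₂, hi₂⟩ : ∃ i₂ : Fin d, i₂ = ⟨1, by omega⟩ := ⟨_, rfl⟩
  have hne : i₁ ≠ i₂ := by rw [hi₁, hi₂]; exact fun h => absurd (Fin.mk.inj_iff.mp h) (by norm_num)
  have hΩ0 : (cubeFam false L a M ρ k) 0 = {x | InBox (sqLo L a ρ k 0) (sqHi L a M ρ k 0) x} := by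
    rw [cubeFam_false_of_le L a M ρ (Nat.zero_le k)]
    show cube L a M ρ k 0 = _
    simp only [cube, tlo_zero, thi_zero]
  have hgs := one_le_gs L k
  have hρ1 : 1 ≤ ρ := hL.trans hρ
  have hc : sqHi L a M ρ k 0 ∈ (cubeFam false L a M ρ k) 0 := by
    rw [hΩ0]
    intro i
    refine ⟨?_, le_rfl⟩
    simp only [sqLo, sqHi, bLo, bHi, Nat.sub_zero]
    have h1 : (1 : ℤ) ≤ (ρ : ℤ) * (gs L k : ℤ) := by
      have : (1 : ℤ) ≤ ρ := by exact_mod_cast hρ1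
      have : (1 : ℤ) ≤ gs L k := by exact_mod_cast hgs
      nlinarith
    have h2 : (0 : ℤ) ≤ (L : ℤ) ^ k * M := by positivity
    push_cast
    nlinarith
  have hmax : ∀ x ∈ (cubeFam false L a M ρ k) 0, x i₁ ≤ sqHi L a M ρ k 0 i₁ ∧ x i₂ ≤ sqHi L a M ρ k 0 i₂ := by
    intro x hx
    rw [hΩ0] at hx
    exact ⟨(hx i₁).2, (hx i₂).2⟩
  have H1 := H 1 le_rfl hk
  simp only [cutFixed_one] at H1
  exact h59_body_false_of_corner hne hL hη 1 (cubeFam false L a M ρ k) (cubeLamS L a M ρ k 1) (cubeLamB L a M ρ k 1) B₀ hcst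
    (sqHi L a M ρ k 0) hc hmax (fun j _ => cubeFam_subset_zero hL a M hρ k j)
    (fun j hj q hq x hx => cubeFam_subset_zero hL a M hρ k j (hbox_cubeLamB L a M ρ k 1 hk j hj q hq x hx))
    (fun j hj y hy x hx => cubeFam_subset_zero hL a M hρ k j (htw_cubeLamS hL a M ρ k 1 hk j hj y hy x hx)) H1

#print axioms h59₁_false_at_one_cubeMember

/-- ★ **v1.1 — THE SAME WITH THE PRINTED EXPONENT CONSTANT OF `H59₁`** (`c⋆-expression = 2L·5dLB₀(L³α₀ + 6dL²Mα₀) + 8·8B₀′·5dLB₀(L³α₀ + 6dL²Mα₀)`,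
`B₀, B₀′, α₀ > 0`): the hypothesis `H59₁` of `B8Prop6CubeMemberFlatScalar.prop6_cubeMember_flat_of_real` (p493514) ∕
`B8Prop6CubeMemberFlat3.prop6_exists_cubeMember_at₃` (p470341), read VERBATIM at `U₀ := 1`, is `False` — a literal instance of
`h59₁_false_at_one_cubeMember` (referee read-check aid). [cite: Balaban1985RegularSpaces, (1.59) p.86, Thm 4 p.88, Prop. 6 p.99, (1.131) p.99] -/
theorem h59₁_printedConst_false_at_one_cubeMember (hd2 : 2 ≤ d) {L : ℕ} (hL : 1 ≤ L) {η : ℝ} (hη : 0 < η) (a : Site d) (M : ℕ) {ρ : ℕ}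
    (hρ : L ≤ ρ) {k : ℕ} (hk : 1 ≤ k) (B₀ : ℝ) {B₀e B₀' α₀ : ℝ} (hB₀e : 0 < B₀e) (hB₀' : 0 < B₀') (hα₀ : 0 < α₀) :
    ¬ (∀ m, 1 ≤ m → m ≤ k → ∀ (u : Site d → 𝔸ˣ) (W : Site d → Fin d → 𝔸ˣ) (A' : Site d → Fin d → 𝔸),
        (∀ x, u x ∈ unitaryUnits 𝔸) →
          mgauge (1 : Site d → Fin d → 𝔸ˣ) u W = cutFixed L (tLo a ρ) (tHi a M ρ) (1 : Site d → Fin d → 𝔸ˣ) k (ctr a M) →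
          Restr129 L m ((cubeLamS L a M ρ k) m) (1 : Site d → Fin d → 𝔸ˣ) u →
          IsLandau138W L m η ((cubeFam false L a M ρ k) 0) ((cubeLamS L a M ρ k) m) (1 : Site d → Fin d → 𝔸ˣ) W →
        (∀ y τ, IsSelfAdjoint (A' y τ)) →
        (∀ j, j ≤ m → ∀ y τ, SideTouches ((cubeFam false L a M ρ k) j) y τ →
          W y τ = cfgExp η A' y τ ∧
          ‖A' y τ‖ ≤ (2 * (L * (5 * (d : ℝ) * L * B₀e * (((L : ℝ) ^ 3 * α₀) + (6 * d * (L : ℝ) ^ 2 * M * α₀)))) +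
            8 * (8 * B₀' * (5 * (d : ℝ) * L * B₀e) * (((L : ℝ) ^ 3 * α₀) + (6 * d * (L : ℝ) ^ 2 * M * α₀)))) * ((L : ℝ) ^ j * η)⁻¹) →
        (∀ y τ, (∀ j, j ≤ m → ¬ SideTouches ((cubeFam false L a M ρ k) j) y τ) → A' y τ = 0) →
        msup L m η (-(1 : ℝ)) (fun j (b : Site d × Fin d) => SideTouches ((cubeFam false L a M ρ k) j) b.1 b.2) (fun b => A' b.1 b.2)
        ≤ B₀ * (bondNorm L m η (-(3 : ℝ)) (cubeFam false L a M ρ k) (fun x μ => Jcur η (1 : Site d → Fin d → 𝔸ˣ) A' μ x)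
        + wsup 1 (fun p : {p : ℕ × (Site d × Fin d) // p.1 ≤ m ∧ p.2 ∈ (cubeLamB L a M ρ k) m p.1} =>
        linCovIter L (1 : Site d → Fin d → 𝔸ˣ) (iEta η A') p.1.1 p.1.2.1 p.1.2.2)) ∧
        msup L m η (-(2 : ℝ)) (fun j (t : Fin d × Fin d × Site d) => SideTouches ((cubeFam false L a M ρ k) j) t.2.2 t.2.1)
        (fun t => covDerivFwd η (1 : Site d → Fin d → 𝔸ˣ) t.1 (fun z => A' z t.2.1) t.2.2)
        ≤ B₀ * (bondNorm L m η (-(3 : ℝ)) (cubeFam false L a M ρ k) (fun x μ => Jcur η (1 : Site d → Fin d → 𝔸ˣ) A' μ x)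
        + wsup 1 (fun p : {p : ℕ × (Site d × Fin d) // p.1 ≤ m ∧ p.2 ∈ (cubeLamB L a M ρ k) m p.1} =>
        linCovIter L (1 : Site d → Fin d → 𝔸ˣ) (iEta η A') p.1.1 p.1.2.1 p.1.2.2))) := by
  have hL0 : (0 : ℝ) < L := by exact_mod_cast hL
  have hd0 : (0 : ℝ) < d := by exact_mod_cast (lt_of_lt_of_le (by norm_num) hd2)
  have hcst : 0 < (2 * (L * (5 * (d : ℝ) * L * B₀e * (((L : ℝ) ^ 3 * α₀) + (6 * d * (L : ℝ) ^ 2 * M * α₀)))) +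
      8 * (8 * B₀' * (5 * (d : ℝ) * L * B₀e) * (((L : ℝ) ^ 3 * α₀) + (6 * d * (L : ℝ) ^ 2 * M * α₀)))) := by positivity
  exact h59₁_false_at_one_cubeMember hd2 hL hη a M hρ hk B₀ hcst

#print axioms h59₁_printedConst_false_at_one_cubeMember

end Sock

end Literature.MathematicalPhysics.QuantumFieldTheory.Balaban1983to89.B8SockH59CornerDefect

end
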